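import Summits.FinalStateConjecture.FinalStateConjecture.Theorems.ZeroEnergyKerrOrBombSymplecticDualOfTheBombDefs
import Summits.FinalStateConjecture.FinalStateConjecture.Theorems.ZeroEnergyKerrOrBombStationaryLimitReductionTimeEquivariantMaps
import Literature.Geometry.Manifold.InverseFunctionTheorem
import Literature.Geometry.Manifold.DirectLimitManifold
import Literature.Geometry.Manifold.OpenSubmanifoldMFDeriv
import HarnessLib

/-!
# Route ZeroEnergyKerrOrBomb · crux `StationaryLimitReduction` (stmt-FinalStateConjecture-10021), line
# `symplectic-dual-of-the-bomb` — stub R `kerrIsometryRigidity`: the CHART-TRANSFER step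

Helper file (`--supports stmt-FinalStateConjecture-10021`; registered helper
`isKerrCharted_of_chartedExtension`) from the lead's wave-1 stub-worker for
`stub_kerrIsometryRigidity` (lead prover-line-stmt-FinalStateConjecture-10021-a1-0, 2026-08-16).

The conclusion `IsKerrCharted 𝓑 A` of stub R asks for a CHART-LEVEL map `Θ : E4 → E4` of a
horizon-penetrating Kerr–Schild region `Kerr.region a r₀` (`r₋ < r₀ < r₊`) into the adapted chart
domain `A.domain`, smooth, injective, `T`-equivariant (`Θ (x + s e₀) = Θ x + (c s) e₀`), isometric
on the exterior `{r > r₊}` from `Kerr.bilin M a` to the chart components `A.bilin = φ^* g_𝓑`, and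
anchored (`Θ '' exterior` = the chart preimage of the d.o.c.). The classical route produces instead
a SPACETIME-LEVEL map `Φ : Kerr.region a r₀ → 𝓑` (the Kerr isometry of the d.o.c., made
future-preserving and extended across `r = r₊` along the transverse null generators) which is
smooth, injective, valued in `range φ`, infinitesimally `T`-equivariant (`dΦ (e₀) = c T`),
isometric on the exterior and onto the d.o.c. there. This file proves, fact-free, that such a `Φ`
yields `IsKerrCharted 𝓑 A` with `Θ := φ⁻¹ ∘ Φ`, provided `φ = A.toFun` is an IMMERSION (clause (3)
of `ChartIsAsymptoticallyCartesian`):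

* `isLocalDiffeomorph_adaptedChart` — an adapted chart with injective
  differentials is a local diffeomorphism (inverse function theorem between `4`-manifolds), hence
  (`contMDiffOn_adaptedChart_symm`) its inverse `φ⁻¹ : range φ → A.domain` is `C^∞`;
* `add_smul_of_fderiv_basisVector_zero` — INTEGRATION of infinitesimal equivariance: on a
  time-translation invariant open set, `dΘ (e₀) = c e₀` everywhere forces
  `Θ (x + s e₀) = Θ x + (c s) e₀` (the curve `s ↦ Θ (x + s e₀) - (c s) e₀` has zero derivative);
* `kerrRegion_nonempty` — `Kerr.region a r₀ ≠ ∅` (a far slice point), so that `A.domain` is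
  nonempty and `A⁻¹` is the inverse of the open partial homeomorphism of `A`;
* `isKerrCharted_of_chartedExtension` — the registered helper: smoothness (`φ⁻¹` smooth on
  `range φ ⊇ Φ (region)`), injectivity, `MapsTo` (by typing), equivariance (the two items above),
  `d(φ⁻¹ ∘ Φ)(e₀) = c e₀` (from `dΦ (e₀) = c T = c dφ (e₀)` and the injectivity of `dφ`), the
  isometry clause (`A.bilin_eq` + the chain rule `dφ ∘ d(φ⁻¹ ∘ Φ) = dΦ`) and anchoring (`φ` is
  injective). The time-translation invariance of `Kerr.region` is taken from the sibling helper file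
  `…StationaryLimitReductionTimeEquivariantMaps` (`kerrRegion_add_smul_mem`).

Finding of this worker on stub R as REGISTERED (reported to the lead, not used here): it is false as
typed — Schwarzschild `{r > r₀'}` minus the closed `T`-invariant future set `closure (J⁺(one horizon
generator))`, read in the identity chart, satisfies every hypothesis (`InTelescope`: the horizon
`ℝ × (S² ∖ pt)` is connected and non-degenerate, global hyperbolicity survives the removal of a
closed future set) while every admissible `Θ` is `(v, y) ↦ (v + τ, R y)` on the closed exterior and
so hits the deleted generator; the missing hypothesis is completeness of the horizon (compact
cross-sections, e.g. Chruściel–Costa's `I⁺`-regularity `StationaryAFBlackHole.IsIPlusRegular`). The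
present helper is independent of that repair: it is the fact-free assembly step of any corrected
form of stub R whose conclusion is `IsKerrCharted`.

What is NOT here (the three classical inputs of stub R, none in the tree): the Killing algebra of
sub-extremal Kerr / "a Killing field timelike on a whole AF end is `λ ∂_{t*}`"; the Boyer–Lindquist
reflection `(t, φ) ↦ (−t, −φ)` as an isometry of `Kerr.exterior`; the extension of a
future-preserving `T`-equivariant d.o.c. isometry across `r = r₊`. References: B. O'Neill,
*Semi-Riemannian Geometry* (1983), Ch. 1, Thm. 1.16 (inverse function theorem), Ch. 3, pp. 58–59,
90–91 (isometries, local isometries); J. M. Lee, *Introduction to Smooth Manifolds* (2013),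
Thm. 4.5; S. Alexakis, A. D. Ionescu, S. Klainerman, arXiv:0904.0982, §1.1 (adapted charts
`T = ∂₀`).
-/

set_option linter.dupNamespace false

noncomputable section

open scoped Manifold ContDiff Topology
open Set Filter Function

namespace Summit.FinalStateConjecture.FinalStateConjecture.Theorems.SymplecticDualOfTheBomb

open Literature.Geometry.Lorentzian

/-! ## §R1 Integration of infinitesimal `T`-equivariance -/

section Integrate

variable {S : Set E4} {Θ : E4 → E4} {c : ℝ}

/-- **Infinitesimal `T`-equivariance integrates.** On a time-translation invariant set `S` on
which `Θ` is differentiable with `dΘ_x (e₀) = c e₀` at every point, `Θ (x + s e₀) = Θ x + (c s) e₀`: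
the curve `s ↦ Θ (x + s e₀) - (c s) e₀` has zero derivative on `ℝ`, hence is constant (mean value
theorem, `is_const_of_deriv_eq_zero`). O'Neill 1983, Ch. 1, p. 29 (integral curves of `∂₀`).
[folklore] -/
theorem add_smul_of_fderiv_basisVector_zero
    (hS : ∀ x ∈ S, ∀ s : ℝ, x + s • E4.basisVector 0 ∈ S)
    (hd : ∀ x ∈ S, DifferentiableAt ℝ Θ x)
    (hΘ : ∀ x ∈ S, fderiv ℝ Θ x (E4.basisVector 0) = c • E4.basisVector 0)
    {x : E4} (hx : x ∈ S) (s : ℝ) :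
    Θ (x + s • E4.basisVector 0) = Θ x + (c * s) • E4.basisVector 0 := by
  -- the curve `γ s = Θ (x + s e₀) - (c s) e₀`
  set γ : ℝ → E4 := fun s ↦ Θ (x + s • E4.basisVector 0) - (c * s) • E4.basisVector 0 with hγ
  have hline : ∀ s : ℝ, HasDerivAt (fun s : ℝ ↦ x + s • E4.basisVector 0)
      ((1 : ℝ) • E4.basisVector 0) s :=
    fun s ↦ ((hasDerivAt_id s).smul_const (E4.basisVector 0)).const_add x
  have hderiv : ∀ s : ℝ, HasDerivAt γ 0 s := by
    intro s
    have hxs : x + s • E4.basisVector 0 ∈ S := hS x hx s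
    have h1 : HasDerivAt (fun s : ℝ ↦ Θ (x + s • E4.basisVector 0))
        (fderiv ℝ Θ (x + s • E4.basisVector 0) ((1 : ℝ) • E4.basisVector 0)) s :=
      HasFDerivAt.comp_hasDerivAt_of_eq s (hd _ hxs).hasFDerivAt (hline s) rfl
    rw [one_smul, hΘ _ hxs] at h1
    have h2 : HasDerivAt (fun s : ℝ ↦ (c * s) • E4.basisVector 0) ((c * 1) • E4.basisVector 0) s :=
      ((hasDerivAt_id s).const_mul c).smul_const (E4.basisVector 0)
    rw [mul_one] at h2
    have h3 := h1.sub h2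
    rwa [sub_self] at h3
  have hdiff : Differentiable ℝ γ := fun s ↦ (hderiv s).differentiableAt
  have hconst := is_const_of_deriv_eq_zero hdiff (fun s ↦ (hderiv s).deriv) s 0
  simp only [hγ, zero_smul, mul_zero, add_zero, sub_zero] at hconst
  rw [← hconst, sub_add_cancel]

end Integrate

/-! ## §R2 Immersed adapted charts are local diffeomorphisms with smooth inverse -/

section Chart

variable {𝓑 : StationaryAFBlackHole.{0}} (A : 𝓑.AdaptedChart)

/-- **An adapted chart with injective differentials is a local diffeomorphism** (inverse function
theorem between the `4`-manifolds `A.domain ⊆ E4` and `𝓑.carrier`: an injective linear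
endomorphism of `E4` is an automorphism). O'Neill 1983, Ch. 1, Thm. 1.16; Lee 2013, Thm. 4.5.
[folklore] -/
theorem isLocalDiffeomorph_adaptedChart
    (hA : ∀ x : A.domain, Function.Injective (mfderiv 𝓘(ℝ, E4) (𝓡 4) A.toFun x)) :
    IsLocalDiffeomorph 𝓘(ℝ, E4) (𝓡 4) ∞ A.toFun := by
  intro x
  set L : E4 →L[ℝ] E4 := mfderiv 𝓘(ℝ, E4) (𝓡 4) A.toFun x with hL
  have hinj : Function.Injective (L : E4 →ₗ[ℝ] E4) := hA x
  set e : E4 ≃ₗ[ℝ] E4 := LinearMap.linearEquivOfInjective (L : E4 →ₗ[ℝ] E4) hinj rfl with he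
  refine Literature.Geometry.Manifold.isLocalDiffeomorphAt_of_mfderiv (I := 𝓘(ℝ, E4)) (J := 𝓡 4)
    (n := ∞) (by simp) isOpen_univ (mem_univ x) A.contMDiff.contMDiffOn
    e.toContinuousLinearEquiv ?_
  ext v
  rfl

/-- **The inverse of an immersed adapted chart is smooth on its range** (`φ⁻¹ : range φ → A.domain`,
realised as the inverse of the open partial homeomorphism of the open embedding `φ`).
O'Neill 1983, Ch. 1, Thm. 1.16. [folklore] -/
theorem contMDiffOn_adaptedChart_symm [Nonempty A.domain]
    (hA : ∀ x : A.domain, Function.Injective (mfderiv 𝓘(ℝ, E4) (𝓡 4) A.toFun x)) :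
    ContMDiffOn (𝓡 4) 𝓘(ℝ, E4) ∞ (A.isOpenEmbedding.toOpenPartialHomeomorph A.toFun).symm
      (Set.range A.toFun) :=
  (isLocalDiffeomorph_adaptedChart A hA).contMDiffOn_symm_of_injective A.isOpenEmbedding.injective

end Chart

/-! ## §R3 The registered helper: a charted horizon-penetrating extension gives `IsKerrCharted` -/

/-- `Kerr.region a r₀` is nonempty: the slice point `(0, y)` with `‖y‖ = R + 1`,
`R = Kerr.afRadius a r₀`, lies in it (`Kerr.mem_slice_of_lt_norm`). Dafermos–Rodnianski
arXiv:0811.0354, §5.1. [folklore] -/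
theorem kerrRegion_nonempty (a r₀ : ℝ) : (Kerr.region a r₀ : Set E4).Nonempty := by
  set y : E3 := EuclideanSpace.single (0 : Fin 3) (Kerr.afRadius a r₀ + 1) with hy
  have hny : ‖y‖ = Kerr.afRadius a r₀ + 1 := by
    have h : ‖y‖ = ‖Kerr.afRadius a r₀ + 1‖ := by simp [hy]
    rw [h, Real.norm_eq_abs, abs_of_pos]
    linarith [Kerr.afRadius_pos a r₀]
  refine ⟨E4.ofTimeSpace 0 y, Kerr.mem_slice_iff_ofTimeSpace_mem_region.1 (Kerr.mem_slice_of_lt_norm ?_)⟩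
  rw [hny]
  linarith

open Literature.Geometry.Manifold in
/-- **Registered helper `isKerrCharted_of_chartedExtension`** (the chart-transfer step of stub R
`kerrIsometryRigidity`). Let `A` be an adapted chart of `𝓑` with injective differentials
(an immersion, clause (3) of `ChartIsAsymptoticallyCartesian`), and let `Φ : E4 → 𝓑` (junk off
`Kerr.region a r₀`, `r₋ < r₀ < r₊`, `|a| < M`, `c > 0`) be smooth and injective on the region,
valued in `range A.toFun`, infinitesimally `T`-equivariant (`dΦ_x (e₀) = c T (Φ x)`), isometric on
the exterior `{r > r₊}` from `Kerr.bilin M a` to `g_𝓑`, with `Φ '' exterior = ⟨⟨M_ext⟩⟩`. Then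
`IsKerrCharted 𝓑 A` holds with `Θ := A⁻¹ ∘ Φ`: `A⁻¹` is smooth on `range A` (inverse function
theorem, `contMDiffOn_adaptedChart_symm`), `dΘ (e₀) = c e₀` because `dA (dΘ e₀) = dΦ e₀ = c T =
dA (c e₀)` and `dA` is injective (`A.mfderiv_toFun_basisVector`), which integrates to
`Θ (x + s e₀) = Θ x + (c s) e₀` (`add_smul_of_fderiv_basisVector_zero`); the isometry clause is
`A.bilin_eq` and the chain rule `dA ∘ dΘ = dΦ`; anchoring uses the injectivity of `A`.
O'Neill 1983, Ch. 1, Thm. 1.16 and Ch. 3, pp. 58–59. [folklore] -/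
theorem isKerrCharted_of_chartedExtension : ∀ (𝓑 : StationaryAFBlackHole.{0}) (A : 𝓑.AdaptedChart) (M a c r₀ : ℝ) (Φ : E4 → 𝓑.carrier), Kerr.IsSubextremal M a → 0 < c → Kerr.rMinus M a < r₀ → r₀ < Kerr.rPlus M a → (∀ x : A.domain, Function.Injective (mfderiv 𝓘(ℝ, E4) (𝓡 4) A.toFun x)) → ContMDiffOn 𝓘(ℝ, E4) (𝓡 4) ∞ Φ (Kerr.region a r₀ : Set E4) → Set.InjOn Φ (Kerr.region a r₀ : Set E4) → Set.MapsTo Φ (Kerr.region a r₀ : Set E4) (Set.range A.toFun) → (∀ x ∈ (Kerr.region a r₀ : Set E4), mfderiv 𝓘(ℝ, E4) (𝓡 4) Φ x (E4.basisVector 0) = c • 𝓑.killing (Φ x)) → (∀ x ∈ (Kerr.exterior M a : Set E4), ∀ v w : E4, 𝓑.metric.val (Φ x) (mfderiv 𝓘(ℝ, E4) (𝓡 4) Φ x v) (mfderiv 𝓘(ℝ, E4) (𝓡 4) Φ x w) = Kerr.bilin M a x v w) → Φ '' (Kerr.exterior M a : Set E4) = 𝓑.doc → IsKerrCharted 𝓑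 A := by
  intro 𝓑 A M a c r₀ Φ hMa hc hr₀ hr₀' hA hΦs hΦi hΦr hΦT hΦiso hΦdoc
  -- notation and elementary facts
  set S : Set E4 := (Kerr.region a r₀ : Set E4) with hS
  have hSo : IsOpen S := (Kerr.region a r₀).isOpen
  have hSinv : ∀ x ∈ S, ∀ s : ℝ, x + s • E4.basisVector 0 ∈ S :=
    kerrRegion_add_smul_mem a r₀
  have hext : (Kerr.exterior M a : Set E4) ⊆ S := Kerr.region_mono a hr₀'.le
  -- the chart domain is nonempty (it receives the nonempty region through `Φ`)
  obtain ⟨x₀, hx₀⟩ := kerrRegion_nonempty a r₀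
  obtain ⟨u₀, -⟩ := hΦr hx₀
  haveI : Nonempty A.domain := ⟨u₀⟩
  -- the smooth inverse `g = A⁻¹` on `range A`
  set g : 𝓑.carrier → A.domain := ⇑(A.isOpenEmbedding.toOpenPartialHomeomorph A.toFun).symm with hg
  have hgA : ∀ u : A.domain, g (A.toFun u) = u := fun u ↦
    A.isOpenEmbedding.toOpenPartialHomeomorph_left_inv A.toFun
  have hAg : ∀ p ∈ Set.range A.toFun, A.toFun (g p) = p := fun p hp ↦
    A.isOpenEmbedding.toOpenPartialHomeomorph_right_inv A.toFun hp
  have hgs : ContMDiffOn (𝓡 4) 𝓘(ℝ, E4) ∞ g (Set.range A.toFun) :=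
    contMDiffOn_adaptedChart_symm A hA
  -- `Ψ = A⁻¹ ∘ Φ : E4 → A.domain` and `Θ = val ∘ Ψ : E4 → E4`
  set Ψ : E4 → A.domain := fun x ↦ g (Φ x) with hΨ
  set Θ : E4 → E4 := fun x ↦ ((Ψ x : A.domain) : E4) with hΘ
  have hAΨ : ∀ x ∈ S, A.toFun (Ψ x) = Φ x := fun x hx ↦ hAg _ (hΦr hx)
  -- smoothness
  have hΨs : ContMDiffOn 𝓘(ℝ, E4) 𝓘(ℝ, E4) ∞ Ψ S := hgs.comp hΦs hΦr
  have hΘs : ContMDiffOn 𝓘(ℝ, E4) 𝓘(ℝ, E4) ∞ Θ S := contMDiff_subtype_val.comp_contMDiffOn hΨs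
  have hΘs' : ContDiffOn ℝ ∞ Θ S := contMDiffOn_iff_contDiffOn.mp hΘs
  have hΨd : ∀ x ∈ S, MDifferentiableAt 𝓘(ℝ, E4) 𝓘(ℝ, E4) Ψ x := fun x hx ↦
    (hΨs.contMDiffAt (hSo.mem_nhds hx)).mdifferentiableAt (by simp)
  have hΘd : ∀ x ∈ S, DifferentiableAt ℝ Θ x := fun x hx ↦
    (hΘs'.contDiffAt (hSo.mem_nhds hx)).differentiableAt (by simp)
  -- chain rule `dA ∘ dΨ = dΦ` on `S`
  have hchain : ∀ x ∈ S, ∀ v : E4,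
      mfderiv 𝓘(ℝ, E4) (𝓡 4) A.toFun (Ψ x) (mfderiv 𝓘(ℝ, E4) 𝓘(ℝ, E4) Ψ x v) =
        mfderiv 𝓘(ℝ, E4) (𝓡 4) Φ x v := by
    intro x hx v
    have hAx : MDifferentiableAt 𝓘(ℝ, E4) (𝓡 4) A.toFun (Ψ x) :=
      A.contMDiff.mdifferentiableAt (by simp)
    have hcomp := mfderiv_comp x hAx (hΨd x hx)
    have hev : (A.toFun ∘ Ψ) =ᶠ[𝓝 x] Φ :=
      Filter.eventuallyEq_of_mem (hSo.mem_nhds hx) fun y hy ↦ hAΨ y hy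
    rw [hev.mfderiv_eq] at hcomp
    rw [hcomp]
    rfl
  -- `dΘ = dΨ` (the inclusion of the open submanifold `A.domain ⊆ E4` has identity differential)
  have hΘΨ : ∀ x ∈ S, ∀ v : E4, fderiv ℝ Θ x v = mfderiv 𝓘(ℝ, E4) 𝓘(ℝ, E4) Ψ x v := by
    intro x hx v
    have h := mfderiv_comp x (OpenSubmanifold.mdifferentiableAt_subtype_val (I := 𝓘(ℝ, E4)) (Ψ x))
      (hΨd x hx)
    rw [OpenSubmanifold.mfderiv_subtype_val] at h
    have h' : mfderiv 𝓘(ℝ, E4) 𝓘(ℝ, E4) (Subtype.val ∘ Ψ) x v = mfderiv 𝓘(ℝ, E4) 𝓘(ℝ, E4) Ψ x v := by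
      rw [h]
      rfl
    rw [← mfderiv_eq_fderiv]
    exact h'
  -- transport of points inside `𝓑.killing` / `𝓑.metric.val` (the fibres are all `E4`)
  have keyT : ∀ p q : 𝓑.carrier, p = q → (𝓑.killing p : E4) = 𝓑.killing q := by
    rintro p q rfl; rfl
  have keyG : ∀ p q : 𝓑.carrier, p = q → ∀ v w : E4, 𝓑.metric.val p v w = 𝓑.metric.val q v w := by
    rintro p q rfl v w; rfl
  -- infinitesimal `T`-equivariance of `Θ`
  have hΘe₀ : ∀ x ∈ S, fderiv ℝ Θ x (E4.basisVector 0) = c • E4.basisVector 0 := by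
    intro x hx
    rw [hΘΨ x hx]
    apply hA (Ψ x)
    have h1 : mfderiv 𝓘(ℝ, E4) (𝓡 4) A.toFun (Ψ x) (c • E4.basisVector 0) =
        c • mfderiv 𝓘(ℝ, E4) (𝓡 4) A.toFun (Ψ x) (E4.basisVector 0) :=
      (mfderiv 𝓘(ℝ, E4) (𝓡 4) A.toFun (Ψ x)).map_smul c (E4.basisVector 0)
    rw [hchain x hx, hΦT x hx, h1, A.mfderiv_toFun_basisVector (Ψ x), keyT _ _ (hAΨ x hx)]
    rfl
  -- `T`-equivariance
  have hΘT : ∀ x ∈ S, ∀ s : ℝ, Θ (x + s • E4.basisVector 0) = Θ x + (c * s) • E4.basisVector 0 :=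
    fun x hx s ↦ add_smul_of_fderiv_basisVector_zero hSinv hΘd hΘe₀ hx s
  -- injectivity and range
  have hΘinj : Set.InjOn Θ S := by
    intro x hx y hy hxy
    have h1 : Ψ x = Ψ y := Subtype.ext hxy
    have h2 : Φ x = Φ y := by rw [← hAΨ x hx, ← hAΨ y hy, h1]
    exact hΦi hx hy h2
  have hΘmaps : Set.MapsTo Θ S (A.domain : Set E4) := fun x _ ↦ (Ψ x).2
  -- isometry on the exterior
  have hΘiso : ∀ x ∈ (Kerr.exterior M a : Set E4), ∀ v w : E4,
      A.bilin (Θ x) (fderiv ℝ Θ x v) (fderiv ℝ Θ x w) = Kerr.bilin M a x v w := by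
    intro x hx v w
    have hxS : x ∈ S := hext hx
    rw [show Θ x = (Ψ x).1 from rfl, A.bilin_eq (Ψ x)]
    change 𝓑.metric.val (A.toFun (Ψ x)) (mfderiv 𝓘(ℝ, E4) (𝓡 4) A.toFun (Ψ x) (fderiv ℝ Θ x v))
      (mfderiv 𝓘(ℝ, E4) (𝓡 4) A.toFun (Ψ x) (fderiv ℝ Θ x w)) = _
    rw [hΘΨ x hxS v, hΘΨ x hxS w, hchain x hxS v, hchain x hxS w, keyG _ _ (hAΨ x hxS)]
    exact hΦiso x hx v w
  -- anchoring
  have hΘanchor : Θ '' (Kerr.exterior M a : Set E4) =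
      {u : E4 | ∃ h : u ∈ A.domain, A.toFun ⟨u, h⟩ ∈ 𝓑.doc} := by
    ext u
    constructor
    · rintro ⟨x, hx, rfl⟩
      refine ⟨(Ψ x).2, ?_⟩
      rw [Subtype.coe_eta, hAΨ x (hext hx), ← hΦdoc]
      exact Set.mem_image_of_mem Φ hx
    · rintro ⟨hu, hdoc⟩
      rw [← hΦdoc] at hdoc
      obtain ⟨x, hx, hxu⟩ := hdoc
      refine ⟨x, hx, ?_⟩
      have h : Ψ x = ⟨u, hu⟩ := by rw [hΨ]; dsimp only; rw [hxu, hgA]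
      rw [hΘ]; dsimp only; rw [h]
  exact ⟨M, a, c, r₀, Θ, hMa, hc, hr₀, hr₀', hΘs', hΘinj, hΘmaps, hΘT, hΘiso, hΘanchor⟩

end Summit.FinalStateConjecture.FinalStateConjecture.Theorems.SymplecticDualOfTheBomb

end
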